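import Literature.Topology.Algebra.RestrictedProduct.Units
import Literature.NumberTheory.Automorphic.UnitaryGroupRestrictedProduct
import Mathlib.Topology.Homeomorph.Lemmas

/-!
# Splitting off finitely many places: `U(J)(𝔸_{F,f}) ≃ₜ* (∏_{v∈S} U(J)(F_v)) × ∏'_{v∉S} U(J)(F_v)`

Build stream 29 (K2Liu, owner of the doubling ∕ local-seam carriers), leaf D7′ of the «LOCAL SEAM» dependency map
`Summits/HodgeConjecture/HodgeConjecture/Cruxes/HLiu418/Lines/K2_Liu_LocalSeam_s23.md` (v2.1, §2 (LS1)); LEAD ruling «M-154r»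
(2026-09-03, Q2): the place splitting is a DEFS leaf, the Haar-measure product identity over it is a SOCKET (#21s), not a def.

## §1  Generic: a restricted product of groups split at a finite set of indices

For groups `G i` with open subgroups `B i` (Mathlib's `RestrictedProduct` with the cofinite filter) and a FINITE set
`S` of indices:

* `fstS G B S : (Πʳ i, [G i, B i]) → Π i : S, G i` and `sndS G B S : (Πʳ i, [G i, B i]) → Πʳ j : {i // i ∉ S}, [G j, B j]`
  (the latter is Mathlib's `RestrictedProduct.mapAlong` along `Subtype.val`, hence continuous);
* `glueS G B S` the inverse gluing `(a, y) ↦ (i ↦ if i ∈ S then a i else y i)`;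
* **`splitEquiv G B S : (Πʳ i, [G i, B i]) ≃ₜ* (Π i : S, G i) × Πʳ j : {i // i ∉ S}, [G j, B j]`** — an isomorphism of
  topological groups; continuity of the gluing is tested, as in ★ `RestrictedProduct/SumIndex.sumEquiv`, on the open set
  `(Π_{i∈S} G i) × (Π_{j∉S} B j)` (★ `continuous_of_isOpenMap_comp`), where it factors through the principal-filter
  restricted product `Πʳ i, [G i, B i]_[𝓟 Sᶜ]` (Mathlib `RestrictedProduct.continuous_rng_of_principal` + `continuous_inclusion`).

## §2  The finite-adelic unitary group

* **`splitPlaces F E c N J S : U(J)(𝔸_{F,f}) ≃ₜ* (Π v : S, U(J)(F_v)) × Πʳ v : {v // v ∉ S}, [U(J)(F_v), U(J)(𝒪_v)]`**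
  := ★ `UnitaryGroup.finAdelicEquiv` followed by `splitEquiv`; coordinates = ★ `UnitaryGroup.evalPlace`
  (`splitPlaces_fst_apply`, `splitPlaces_snd_apply_coe`).

This is the standard «`G(𝔸_f) = G(F_S) × G(𝔸_f^S)`» bookkeeping (Platonov–Rapinchuk 1994, §5.1; Borel–Jacquet 1979, §4.1;
Cassels–Fröhlich 1967, Ch. II §§14–16 for the ideles).  Everything is proved (Mathlib + tree only); no `instance`,
no `notation`, no `sorry`.  Decidability of membership in `S` is an explicit hypothesis (`[DecidableEq ι]`), never a
local classical instance.
-/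

set_option autoImplicit false

noncomputable section

open Topology Filter Set
open scoped RestrictedProduct

namespace Literature.NumberTheory.K2Lit.PlaceSplitting

open Literature.Topology.Algebra.RestrictedProduct (continuous_of_isOpenMap_comp)

/-! ## §1  Generic splitting at a finite set of indices -/

section generic

variable {ι : Type*} (G : ι → Type*) [∀ i, Group (G i)] (B : ∀ i, Subgroup (G i)) (S : Finset ι)

/-- The coordinates in `S`. [cite: PlatonovRapinchuk1994, §5.1] -/
def fstS (x : Πʳ i, [G i, B i]) : Π i : S, G i.1 := fun i => x i.1

/-- The coordinates outside `S`, again a restricted product (Mathlib's `mapAlong` along `Subtype.val`).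
[cite: PlatonovRapinchuk1994, §5.1] -/
def sndS (x : Πʳ i, [G i, B i]) : Πʳ j : {i // i ∉ S}, [G j.1, B j.1] :=
  ⟨fun j => x j.1, (Subtype.val_injective.tendsto_cofinite).eventually x.2⟩

/-- Components of `fstS`. [cite: PlatonovRapinchuk1994, §5.1] -/
@[simp] theorem fstS_apply (x : Πʳ i, [G i, B i]) (i : S) : fstS G B S x i = x i.1 := rfl

/-- Components of `sndS`. [cite: PlatonovRapinchuk1994, §5.1] -/
@[simp] theorem sndS_apply (x : Πʳ i, [G i, B i]) (j : {i // i ∉ S}) : sndS G B S x j = x j.1 := rfl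

section topo

variable [∀ i, TopologicalSpace (G i)]

/-- `fstS` is continuous (coordinate evaluations). [cite: PlatonovRapinchuk1994, §5.1] -/
theorem continuous_fstS : Continuous (fstS G B S) :=
  continuous_pi fun i => RestrictedProduct.continuous_eval i.1

/-- `sndS` is continuous: it is Mathlib's `mapAlong` along `Subtype.val`. [cite: PlatonovRapinchuk1994, §5.1] -/
theorem continuous_sndS : Continuous (sndS G B S) :=
  RestrictedProduct.mapAlong_continuous G (fun j : {i // i ∉ S} => G j.1)
    (A₁ := fun i => (B i : Set (G i))) (A₂ := fun j : {i // i ∉ S} => (B j.1 : Set (G j.1)))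
    (𝓕₁ := cofinite) (𝓕₂ := cofinite) Subtype.val Subtype.val_injective.tendsto_cofinite (fun _ => id)
    (Eventually.of_forall fun _ _ hx => hx) (fun _ => continuous_id)

/-- The openness `Fact` for the factors outside `S` (a theorem, to be introduced with `haveI` by users; the tree
files declare no instances). [cite: PlatonovRapinchuk1994, §5.1] -/
theorem fact_isOpen_compl [hBo : Fact (∀ i, IsOpen (B i : Set (G i)))] :
    Fact (∀ j : {i // i ∉ S}, IsOpen (B j.1 : Set (G j.1))) :=
  ⟨fun j => hBo.out j.1⟩

end topo

variable [DecidableEq ι]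

/-- The gluing map `(a, y) ↦ (i ↦ a i for i ∈ S, y i for i ∉ S)`. [cite: PlatonovRapinchuk1994, §5.1] -/
def glueS (y : (Π i : S, G i.1) × (Πʳ j : {i // i ∉ S}, [G j.1, B j.1])) : Πʳ i, [G i, B i] :=
  ⟨fun i => if h : i ∈ S then y.1 ⟨i, h⟩ else y.2 ⟨i, h⟩, by
    have h2 : ∀ᶠ j : {i // i ∉ S} in cofinite, y.2 j ∈ (B j.1 : Set (G j.1)) := y.2.2
    rw [Filter.eventually_cofinite] at h2 ⊢
    refine (S.finite_toSet.union (h2.image Subtype.val)).subset ?_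
    intro i hi
    by_cases h : i ∈ S
    · exact Or.inl h
    · refine Or.inr ⟨⟨i, h⟩, ?_, rfl⟩
      simpa [h] using hi⟩

/-- Components of `glueS` inside `S`. [cite: PlatonovRapinchuk1994, §5.1] -/
@[simp] theorem glueS_apply_of_mem (y : (Π i : S, G i.1) × (Πʳ j : {i // i ∉ S}, [G j.1, B j.1])) {i : ι} (h : i ∈ S) :
    glueS G B S y i = y.1 ⟨i, h⟩ := by
  unfold glueS
  exact dif_pos h

/-- Components of `glueS` outside `S`. [cite: PlatonovRapinchuk1994, §5.1] -/
@[simp] theorem glueS_apply_of_not_mem (y : (Π i : S, G i.1) × (Πʳ j : {i // i ∉ S}, [G j.1, B j.1])) {i : ι}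
    (h : i ∉ S) : glueS G B S y i = y.2 ⟨i, h⟩ := by
  unfold glueS
  exact dif_neg h

/-- **Splitting at `S` as an isomorphism of groups.** [cite: PlatonovRapinchuk1994, §5.1] -/
def splitMulEquiv : (Πʳ i, [G i, B i]) ≃* (Π i : S, G i.1) × (Πʳ j : {i // i ∉ S}, [G j.1, B j.1]) where
  toFun x := (fstS G B S x, sndS G B S x)
  invFun := glueS G B S
  left_inv x := by
    ext i
    by_cases h : i ∈ S
    · rw [glueS_apply_of_mem G B S _ h]; rfl
    · rw [glueS_apply_of_not_mem G B S _ h]; rfl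
  right_inv y := by
    refine Prod.ext (funext fun i => ?_) ?_
    · show fstS G B S (glueS G B S y) i = y.1 i
      rw [fstS_apply, glueS_apply_of_mem G B S _ i.2]
    · ext j
      show sndS G B S (glueS G B S y) j = y.2 j
      rw [sndS_apply, glueS_apply_of_not_mem G B S _ j.2]
  map_mul' _ _ := rfl

/-- `splitMulEquiv` is `(fstS, sndS)`. [cite: PlatonovRapinchuk1994, §5.1] -/
@[simp] theorem splitMulEquiv_apply (x : Πʳ i, [G i, B i]) :
    splitMulEquiv G B S x = (fstS G B S x, sndS G B S x) := rfl

/-- The inverse of `splitMulEquiv` is the gluing map. [cite: PlatonovRapinchuk1994, §5.1] -/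
@[simp] theorem splitMulEquiv_symm_apply (y : (Π i : S, G i.1) × (Πʳ j : {i // i ∉ S}, [G j.1, B j.1])) :
    (splitMulEquiv G B S).symm y = glueS G B S y := rfl

variable [∀ i, TopologicalSpace (G i)] [∀ i, IsTopologicalGroup (G i)] [hBo : Fact (∀ i, IsOpen (B i : Set (G i)))]

/-- **The gluing map is continuous**: tested on the open set `(Π_{i∈S} G i) × (Π_{j∉S} B j)` (open map `id × structureMap`
with `1 ↦ 1`), where it factors through the principal-filter restricted product over `Sᶜ`.
[cite: PlatonovRapinchuk1994, §5.1] -/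
theorem continuous_glueS : Continuous (glueS G B S) := by
  haveI : Fact (∀ j : {i // i ∉ S}, IsOpen (B j.1 : Set (G j.1))) := fact_isOpen_compl G B S
  let i₀ : ((Π i : S, G i.1) × (Π j : {i // i ∉ S}, B j.1)) →
      (Π i : S, G i.1) × (Πʳ j : {i // i ∉ S}, [G j.1, B j.1]) :=
    Prod.map id (RestrictedProduct.structureMap (fun j : {i // i ∉ S} => G j.1)
      (fun j => (B j.1 : Set (G j.1))) cofinite)
  have hi₀ : IsOpenMap i₀ :=
    IsOpenMap.id.prodMap (RestrictedProduct.isOpenEmbedding_structureMap this.out).isOpenMap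
  have h1 : i₀ 1 = 1 := rfl
  have hT : (cofinite : Filter ι) ≤ 𝓟 ((↑S : Set ι)ᶜ) := le_principal_iff.2 S.finite_toSet.compl_mem_cofinite
  let m : ((Π i : S, G i.1) × (Π j : {i // i ∉ S}, B j.1)) → Πʳ i, [G i, B i]_[𝓟 ((↑S : Set ι)ᶜ)] := fun y =>
    ⟨fun i => if h : i ∈ S then y.1 ⟨i, h⟩ else (y.2 ⟨i, h⟩ : G i), by
      rw [Filter.eventually_principal]
      intro i hi
      have h : i ∉ S := fun h' => hi (Finset.mem_coe.2 h')
      show (if h : i ∈ S then y.1 ⟨i, h⟩ else (y.2 ⟨i, h⟩ : G i)) ∈ (B i : Set (G i))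
      rw [dif_neg h]
      exact (y.2 ⟨i, h⟩).2⟩
  have hm : Continuous m := by
    rw [RestrictedProduct.continuous_rng_of_principal]
    refine continuous_pi fun i => ?_
    by_cases h : i ∈ S
    · refine ((continuous_apply (⟨i, h⟩ : S)).comp continuous_fst).congr fun y => ?_
      show y.1 ⟨i, h⟩ = (if h : i ∈ S then y.1 ⟨i, h⟩ else (y.2 ⟨i, h⟩ : G i))
      rw [dif_pos h]
    · refine (continuous_subtype_val.comp ((continuous_apply (⟨i, h⟩ : {i // i ∉ S})).comp
        continuous_snd)).congr fun y => ?_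
      show ((y.2 ⟨i, h⟩ : B i) : G i) = (if h : i ∈ S then y.1 ⟨i, h⟩ else (y.2 ⟨i, h⟩ : G i))
      rw [dif_neg h]
  have hfac : ((splitMulEquiv G B S).symm.toMonoidHom ∘ i₀ :
      ((Π i : S, G i.1) × (Π j : {i // i ∉ S}, B j.1)) → Πʳ i, [G i, B i]) =
      RestrictedProduct.inclusion G (fun i => (B i : Set (G i))) hT ∘ m := by
    funext y
    ext i
    by_cases h : i ∈ S
    · show glueS G B S (i₀ y) i = (if h : i ∈ S then y.1 ⟨i, h⟩ else (y.2 ⟨i, h⟩ : G i))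
      rw [glueS_apply_of_mem G B S _ h, dif_pos h]
      rfl
    · show glueS G B S (i₀ y) i = (if h : i ∈ S then y.1 ⟨i, h⟩ else (y.2 ⟨i, h⟩ : G i))
      rw [glueS_apply_of_not_mem G B S _ h, dif_neg h]
      rfl
  have hc : Continuous ((splitMulEquiv G B S).symm.toMonoidHom ∘ i₀) := by
    rw [hfac]
    exact (RestrictedProduct.continuous_inclusion hT).comp hm
  exact continuous_of_isOpenMap_comp (splitMulEquiv G B S).symm.toMonoidHom i₀ hi₀ h1 hc.continuousAt

/-- **A restricted product of groups splits off its factors at a finite set of indices**, as topological groups: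
`(Πʳ i, [G i, B i]) ≃ₜ* (Π i : S, G i) × Πʳ j : {i // i ∉ S}, [G j, B j]`. [cite: PlatonovRapinchuk1994, §5.1] -/
def splitEquiv : (Πʳ i, [G i, B i]) ≃ₜ* (Π i : S, G i.1) × (Πʳ j : {i // i ∉ S}, [G j.1, B j.1]) :=
  { splitMulEquiv G B S with
    continuous_toFun := (continuous_fstS G B S).prodMk (continuous_sndS G B S)
    continuous_invFun := continuous_glueS G B S }

/-- `splitEquiv` is `(fstS, sndS)`. [cite: PlatonovRapinchuk1994, §5.1] -/
@[simp] theorem splitEquiv_apply (x : Πʳ i, [G i, B i]) :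
    splitEquiv G B S x = (fstS G B S x, sndS G B S x) := rfl

/-- The inverse of `splitEquiv` is the gluing map. [cite: PlatonovRapinchuk1994, §5.1] -/
@[simp] theorem splitEquiv_symm_apply (y : (Π i : S, G i.1) × (Πʳ j : {i // i ∉ S}, [G j.1, B j.1])) :
    (splitEquiv G B S).symm y = glueS G B S y := rfl

/-- Gluing then splitting is the identity. [cite: PlatonovRapinchuk1994, §5.1] -/
theorem splitEquiv_glueS (y : (Π i : S, G i.1) × (Πʳ j : {i // i ∉ S}, [G j.1, B j.1])) :
    splitEquiv G B S (glueS G B S y) = y :=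
  (splitEquiv G B S).apply_symm_apply y

/-- Splitting then gluing is the identity. [cite: PlatonovRapinchuk1994, §5.1] -/
theorem glueS_splitEquiv (x : Πʳ i, [G i, B i]) : glueS G B S (splitEquiv G B S x) = x :=
  (splitEquiv G B S).symm_apply_apply x

end generic

/-! ## §2  The finite-adelic unitary group split at a finite set of places -/

section unitary

open NumberField IsDedekindDomain
open Literature.NumberTheory.Automorphic

variable (F E : Type) [Field F] [NumberField F] [Field E] [NumberField E] [Algebra F E]
variable (c : E ≃ₐ[F] E) (N : ℕ) (J : Matrix (Fin N) (Fin N) E)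
variable (S : Finset (HeightOneSpectrum (𝓞 F))) [DecidableEq (HeightOneSpectrum (𝓞 F))]

/-- **`U(J)(𝔸_{F,f}) ≃ₜ* (Π_{v∈S} U(J)(F_v)) × ∏'_{v∉S} [U(J)(F_v), U(J)(𝒪_v)]`** — splitting off the places in a finite set
`S` (★ `UnitaryGroup.finAdelicEquiv` followed by `splitEquiv`). [cite: PlatonovRapinchuk1994, §5.1] -/
def splitPlaces : UnitaryGroup.finAdelic F E c N J ≃ₜ*
    (Π v : S, UnitaryGroup.localPi E c N J v.1) ×
      (Πʳ v : {v // v ∉ S}, [UnitaryGroup.localPi E c N J v.1, UnitaryGroup.localInt E c N J v.1]) :=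
  (UnitaryGroup.finAdelicEquiv F E c N J).trans
    (splitEquiv (fun v => UnitaryGroup.localPi E c N J v) (fun v => UnitaryGroup.localInt E c N J v) S)

/-- The `S`-coordinates of `splitPlaces` are the place evaluations ★ `UnitaryGroup.evalPlace`.
[cite: PlatonovRapinchuk1994, §5.1] -/
@[simp] theorem splitPlaces_fst_apply (g : UnitaryGroup.finAdelic F E c N J) (v : S) :
    (splitPlaces F E c N J S g).1 v = UnitaryGroup.evalPlace F E c N J v.1 g := rfl

/-- The coordinates of `splitPlaces` outside `S` are the place evaluations ★ `UnitaryGroup.evalPlace`.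
[cite: PlatonovRapinchuk1994, §5.1] -/
@[simp] theorem splitPlaces_snd_apply (g : UnitaryGroup.finAdelic F E c N J) (v : {v // v ∉ S}) :
    (splitPlaces F E c N J S g).2 v = UnitaryGroup.evalPlace F E c N J v.1 g := rfl

/-- `splitPlaces` through ★ `finAdelicEquiv`: first component. [cite: PlatonovRapinchuk1994, §5.1] -/
theorem splitPlaces_fst_eq (g : UnitaryGroup.finAdelic F E c N J) (v : S) :
    (splitPlaces F E c N J S g).1 v = UnitaryGroup.finAdelicEquiv F E c N J g v.1 := rfl

/-- `splitPlaces` through ★ `finAdelicEquiv`: second component. [cite: PlatonovRapinchuk1994, §5.1] -/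
theorem splitPlaces_snd_eq (g : UnitaryGroup.finAdelic F E c N J) (v : {v // v ∉ S}) :
    (splitPlaces F E c N J S g).2 v = UnitaryGroup.finAdelicEquiv F E c N J g v.1 := rfl

/-- The inverse of `splitPlaces` is ★ `finAdelicEquiv.symm` after gluing. [cite: PlatonovRapinchuk1994, §5.1] -/
theorem splitPlaces_symm_apply
    (y : (Π v : S, UnitaryGroup.localPi E c N J v.1) ×
      (Πʳ v : {v // v ∉ S}, [UnitaryGroup.localPi E c N J v.1, UnitaryGroup.localInt E c N J v.1])) :
    (splitPlaces F E c N J S).symm y =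
      (UnitaryGroup.finAdelicEquiv F E c N J).symm
        (glueS (fun v => UnitaryGroup.localPi E c N J v) (fun v => UnitaryGroup.localInt E c N J v) S y) := rfl

end unitary

end Literature.NumberTheory.K2Lit.PlaceSplitting
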